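import Summits.BirchSwinnertonDyer.BirchSwinnertonDyer.Theorems.GenusKolyvaginAtTwoGenusPrimitiveSupplyAtTwoTwistTamagawaOdd
import Summits.BirchSwinnertonDyer.BirchSwinnertonDyer.Theorems.GenusKolyvaginAtTwoGenusPrimitiveSupplyAtTwoTwistLocalFrame
import HarnessLib

/-!
# Route `GenusKolyvaginAtTwo`, crux #2 `GenusPrimitiveSupplyAtTwo` (stmt-BirchSwinnertonDyer-22136):
# Mazur–Rubin Cor. 3.4 (i) with a single finite `T`-place, BOTH DIRECTIONS DECIDED BY STRICTNESS, from the FOUR-row place menu —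
# unconditional, every number field, every elliptic curve (no `ρ̄_{W,2}`-onto), for the CANONICAL identification

Width seat `bsd-line-gk2-p4` g12 (cell `bsd-f1-sign2`), sequel of `…TwistLocalFrame` (§75–§78, three-row menu) and of the LEAD's
`…TwistTamagawaOdd` (the four-row finite menu SPLIT / TAMAGAWA-ODD / BOTH GOOD / SILENT, `transport_twist_agree_off_of_menu`).
THEOREMS ONLY (no definition, no named fact, no `sorry`); helper `--supports stmt-BirchSwinnertonDyer-22136`; no item is closed; BSD is not
proved by any of this.

WHAT. **`natCard_selmerGroup_twist_directed_of_menu_frame`** — for `W/K` elliptic over a number field, `Wd = C • W^{(d)}`, a finite place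
`v₀ ∤ 2` of good reduction for `W` that is RAMIFIED in `K(√d)` (`ι(√d) ∉ K_{v₀}^{nr}`) with `#W(K_{v₀})[2] = 2`, every other finite place
on the FOUR-row menu {split | odd & both Tamagawa numbers odd | odd & good for both | odd & silent for both} and every infinite place on
{split | `H¹ = 0` for both}:
**(`Sel₂(W)` strict at `v₀` ⟹ `#Sel₂(Wd) = #Sel₂(W)·2`) ∧ (`Sel₂(W)` not strict at `v₀` ⟹ `#Sel₂(Wd)·2 = #Sel₂(W)`)** — Mazur–Rubin
Cor. 3.4 (i) with `T = {v₀}` exactly as printed (UP iff `V_T = 0`), with NO displayed fact: Poitou–Tate (`poitouTate_selmerStructure_duality_real_holds`),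
Tate χ (`localEulerPoincareCharacteristic_holds`), Lemma 2.10 (i)/(ii)/(iii)/(iv)/(v) (the menus), Lemma 2.11 and the frame datum for ONE
identification (`exists_intertwining_hsplit_and_transverse_frame`), Kramer's congruence for that FRAMED identification (part 9
`GenusKolyKramer.isSquare_card_selmerGroup_mul_of_frame`). It is the `K`-general kernel form of the Literature named fact
`MazurRubin2010.cor34i_singleton_rat` (discharged over `ℚ` in the sequel file).

References: [MazurRubin2010] Thm. 2.7, Remark 2.4, Lemmas 2.9–2.11, Prop. 3.3, Cor. 3.4 (i); [Kramer1981] Thm. 1, Props. 1, 2, 7;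
[KlagsbrunMazurRubin2013] Thm. 3.9, Lemma 5.2; [MilneADT2006] I Thm. 2.8, Lemma 3.3, Thm. 4.10.
-/

set_option linter.dupNamespace false -- tree convention: `Summit.BirchSwinnertonDyer.BirchSwinnertonDyer.Theorems` (summit = sub-problem)
set_option autoImplicit false

noncomputable section

open scoped Classical ContRepresentation

namespace Summit.BirchSwinnertonDyer.BirchSwinnertonDyer.Theorems.GenusKolyTwistLocal

open WeierstrassCurve Field NumberField IsDedekindDomain Function
open Literature.NumberTheory.EllipticCurves Literature.NumberTheory.GaloisRepresentations
open Literature.NumberTheory.EllipticCurves.DokchitserDokchitser2012 (T xT)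
open Literature.NumberTheory.GaloisRepresentations.IsNonarchimedeanLocalField
open Literature.NumberTheory.GaloisRepresentations.DiscreteGaloisModule (SelmerStructure)
open Literature.NumberTheory.GaloisCohomology
open Summit.BirchSwinnertonDyer.Rank1Residual.X11b
open Summit.BirchSwinnertonDyer.Rank1Residual.X11b.CongruentTransfer
open Summit.BirchSwinnertonDyer.BirchSwinnertonDyer.Theorems.GenusKolyTwistTamagawa (transport_twist_agree_off_of_menu)
open Summit.BirchSwinnertonDyer.BirchSwinnertonDyer.Theorems.SchneiderFreeAdditiveX3.PoitouTateReduction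
  (poitouTate_selmerStructure_duality_real_holds)

variable {K : Type} [Field K] [NumberField K] (W Wd : WeierstrassCurve K) [W.IsElliptic] [Wd.IsElliptic]

/-! ## §79 Cor. 3.4 (i) with `T = {v₀}` finite, both directions, four-row menu — unconditional -/

/-- **MAZUR–RUBIN COR. 3.4 (i) WITH `T = {v₀}`, BOTH DIRECTIONS, UNCONDITIONAL** (every number field `K`, every elliptic `W`, the
canonical identification `E^{(d)}[2] ≅ E[2]`). Data: `Wd = C • W^{(d)}`; `v₀ ∤ 2` good for `W`, ramified in `K(√d)` (`ι(√d) ∉ K_{v₀}^{nr}`),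
`#W(K_{v₀})[2] = 2`; every finite `v ≠ v₀` on the FOUR-row menu (split ∨ odd with both local Tamagawa numbers odd ∨ odd & good for both ∨
odd & silent for both), every infinite place split or with `H¹ = 0` for both. Conclusion: `Sel₂(W)` strict at `v₀` ⟹ `#Sel₂(Wd) = #Sel₂(W)·2`,
and `Sel₂(W)` not strict at `v₀` ⟹ `#Sel₂(Wd)·2 = #Sel₂(W)`. Inputs (all tree theorems): PT with real places, Tate χ, the transport menus,
Lemma 2.11 + the frame datum for one identification, Kramer's congruence for that framed identification.
[cite: MazurRubin2010, Thm. 2.7, Lemmas 2.9–2.11, Prop. 3.3, Cor. 3.4 (i)] [cite: Kramer1981, Thm. 1, Props. 1, 2, 7] [cite: MilneADT2006, I Thm. 2.8, 4.10] -/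
theorem natCard_selmerGroup_twist_directed_of_menu_frame {d : K} (hd : d ≠ 0) {C : VariableChange K}
    (hWd : C • W.quadraticTwist d = Wd)
    (v₀ : HeightOneSpectrum (𝓞 K)) (hv₀ : ((2 : ℕ) : 𝓞 K) ∉ v₀.asIdeal) (hv₀W : W.HasGoodReductionAt v₀)
    (hram : closureEmb (K := K) (v₀.adicCompletion K) (geomSqrt d) ∉ maxUnramified (v₀.adicCompletion K))
    (ht : Nat.card (nsmulAddMonoidHom 2 : (W.baseChange (v₀.adicCompletion K)).toAffine.Point →+ _).ker = 2)
    (hfin : ∀ v : HeightOneSpectrum (𝓞 K), v ≠ v₀ →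
      (∃ s : v.adicCompletion K, s ^ 2 = algebraMap K (v.adicCompletion K) d) ∨
      (((2 : ℕ) : 𝓞 K) ∉ v.asIdeal ∧
        ¬ 2 ∣ (W.baseChange (v.adicCompletion K)).localTamagawaNumber (v.adicCompletionIntegers K) ∧
        ¬ 2 ∣ (Wd.baseChange (v.adicCompletion K)).localTamagawaNumber (v.adicCompletionIntegers K)) ∨
      (((2 : ℕ) : 𝓞 K) ∉ v.asIdeal ∧ W.HasGoodReductionAt v ∧ Wd.HasGoodReductionAt v) ∨
      (((2 : ℕ) : 𝓞 K) ∉ v.asIdeal ∧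
        Nat.card (nsmulAddMonoidHom 2 : (W.baseChange (v.adicCompletion K)).toAffine.Point →+ _).ker = 1 ∧
        Nat.card (nsmulAddMonoidHom 2 : (Wd.baseChange (v.adicCompletion K)).toAffine.Point →+ _).ker = 1))
    (hinf : ∀ w : InfinitePlace K,
      (∃ s : w.Completion, s ^ 2 = algebraMap K w.Completion d) ∨
      ((∀ x : galoisCohomology (W.localGaloisModule w.Completion) 1, x = 0) ∧
        (∀ x : galoisCohomology (Wd.localGaloisModule w.Completion) 1, x = 0))) :
    ((∀ c ∈ (W.kummerSelmerStructure ((2 : ℕ) : ℤ)).selmerGroup,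
        galoisCohomology.localization (W.torsionGaloisModule ((2 : ℕ) : ℤ)) (Sum.inr v₀) 1 c = 0) →
      Nat.card (Wd.selmerGroup ((2 : ℕ) : ℤ)) = Nat.card (W.selmerGroup ((2 : ℕ) : ℤ)) * 2) ∧
    ((∃ c ∈ (W.kummerSelmerStructure ((2 : ℕ) : ℤ)).selmerGroup,
        galoisCohomology.localization (W.torsionGaloisModule ((2 : ℕ) : ℤ)) (Sum.inr v₀) 1 c ≠ 0) →
      Nat.card (Wd.selmerGroup ((2 : ℕ) : ℤ)) * 2 = Nat.card (W.selmerGroup ((2 : ℕ) : ℤ))) := by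
  haveI : Fact (Nat.Prime 2) := ⟨Nat.prime_two⟩
  have hPT := poitouTate_selmerStructure_duality_real_holds (K := K)
  have hEP : ∀ v : HeightOneSpectrum (𝓞 K), localEulerPoincareCharacteristic (v.adicCompletion K) := fun v ↦
    haveI : CharZero (v.adicCompletion K) := charZero_of_injective_algebraMap (algebraMap K _).injective
    localEulerPoincareCharacteristic_holds (v.adicCompletion K)
  -- the canonical identification: split agreement, Lemma 2.11, frame datum
  obtain ⟨φ, ψ, hψφ, hφψ, hsplit, htr, π, A, hπ, hA⟩ := exists_intertwining_hsplit_and_transverse_frame W Wd hd hWd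
  let 𝓐 : SelmerStructure (W.torsionGaloisModule ((2 : ℕ) : ℤ)) := fun v ↦
    (Wd.kummerSelmerStructure ((2 : ℕ) : ℤ) v).map (galoisCohomology.map (φ.restrictField (Place.Completion v)) 1)
  have h𝓐 : ∀ v, 𝓐 v = (Wd.kummerSelmerStructure ((2 : ℕ) : ℤ) v).map
      (galoisCohomology.map (φ.restrictField (Place.Completion v)) 1) := fun _ ↦ rfl
  -- agreement off `v₀` from the four-row menu
  have hagree : ∀ v : Place K, v ≠ Sum.inr v₀ → 𝓐 v = W.kummerSelmerStructure ((2 : ℕ) : ℤ) v :=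
    transport_twist_agree_off_of_menu W φ ψ hφψ hsplit 𝓐 h𝓐 (Sum.inr v₀)
      (fun v hv ↦ hfin v fun h ↦ hv (by rw [h])) (fun w _ ↦ hinf w)
  -- transversality at `v₀` (Lemma 2.11)
  have htr' : 𝓐 (Sum.inr v₀) ⊓ W.kummerSelmerStructure ((2 : ℕ) : ℤ) (Sum.inr v₀) = ⊥ := by
    rw [h𝓐, kummerSelmerStructure_apply, kummerSelmerStructure_apply]
    exact htr v₀ hv₀W hv₀ hram
  -- `t_{v₀} = 2`
  have ht' : Nat.card (nsmulAddMonoidHom 2 : (W.baseChange (v₀.adicCompletion K)).toAffine.Point →+ _).ker *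
      Nat.card (v₀.adicCompletionIntegers K ⧸ Ideal.span {((2 : ℕ) : v₀.adicCompletionIntegers K)}) = 2 := by
    rw [ht, natCard_quotient_span_natCast_eq_one_of_not_mem v₀ hv₀, mul_one]
  -- the parity of the pair at `S = {v₀}`: Kramer's congruence for the framed `φ` (part 9)
  have hpar : IsSquare (Nat.card (Wd.selmerGroup ((2 : ℕ) : ℤ)) * Nat.card (W.selmerGroup ((2 : ℕ) : ℤ)) *
      (𝓐 (Sum.inr v₀)).relIndex (W.kummerSelmerStructure ((2 : ℕ) : ℤ) (Sum.inr v₀))) := by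
    have hS : ∀ v ∉ ({(Sum.inr v₀ : Place K)} : Finset (Place K)), 𝓐 v = W.kummerSelmerStructure ((2 : ℕ) : ℤ) v :=
      fun v hv ↦ hagree v (by simpa using hv)
    have h := GenusKolyKramer.isSquare_card_selmerGroup_mul_of_frame W Wd φ (Function.LeftInverse.injective hψφ) π hπ A hA
      𝓐 h𝓐 {(Sum.inr v₀ : Place K)} hS
    rwa [Finset.prod_singleton] at h
  refine ⟨fun hstrict ↦ ?_, fun hns ↦ ?_⟩
  · exact natCard_selmerGroup_eq_mul_of_transverse_of_forall_localization_eq_zero W Wd 2 hPT hEP φ ψ hψφ hφψ 𝓐 h𝓐 v₀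
      hagree htr' ht' hstrict hpar
  · exact natCard_selmerGroup_mul_eq_of_transverse_of_localization_ne_zero W Wd 2 hPT hEP φ ψ hψφ hφψ 𝓐 h𝓐 v₀
      hagree htr' ht' hns

end Summit.BirchSwinnertonDyer.BirchSwinnertonDyer.Theorems.GenusKolyTwistLocal

end
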